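import Summits.Ventures.HodgeRepro2.T5UnipotentCommutator

/-!
# T5BorelHyperbolic — the Borel subgroup of U(ℍ) is `T ⋉ N`, and `N` is its derived subgroup
(cell pub-hodge-repro2, seat p3)

Companion of `T5UnipotentCommutator` (file 23). There the unipotent elements
`u(x) = !![1, x; 0, 1]` (`x̄ = -x`) of `U(ℍ)` were shown to be commutators. Here the BOREL
`B = {g ∈ U(ℍ) : g₁₀ = 0}` — the stabiliser of the isotropic line `⟨e₁⟩` (`mem_borel_iff_stabilizes`)
— is analysed:

* `exists_diag_mul_unip`: every `g ∈ B` is `d(g₀₀) · u(g₀₀⁻¹ g₀₁)` with `g₀₀ ≠ 0` and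
  `star (g₀₀⁻¹ g₀₁) = -(g₀₀⁻¹ g₀₁)` — `B = T ⋉ N`;
* `torusHom : borel E →* Eˣ` (`g ↦ g₀₀`) with kernel exactly `N` (`mem_ker_torusHom_iff`);
* `commutator_borel_le_unipotent`: `[B, B] ≤ N` (the quotient `B/N ≅ T` is abelian);
* `unipotent_le_commutator_borel`: `N ≤ [B, B]` (file 23's commutator identity, inside `B`);
* `commutator_borel_eq_unipotent`: `[B, B] = N` as soon as some `t ≠ 0` has `t t̄ ≠ 1`;
* `character_borel_unip_eq_one`: every character of `B` is trivial on `N`.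

So `N` is characterised inside `B` without any reference to unipotence: it is the derived
subgroup of the stabiliser of the isotropic line (MVW's `P′₁` of T5-SUPPORT-p3 §14(d), Q-7, once
that parabolic is identified with the stabiliser of an isotropic line of the fixed flag — prose).
Standard axioms.
-/

namespace Summit.Ventures.HodgeRepro2.T5BorelHyperbolic

open Matrix
open scoped commutatorElement
open T5UnipotentCommutator

variable {E : Type*} [Field E] [StarRing E]

/-- The `(i, j)` entry of an element of `U(ℍ)`. -/
def entry (g : hypUnitary E) (i j : Fin 2) : E :=
  ((g : GL (Fin 2) E) : Matrix (Fin 2) (Fin 2) E) i j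

/-- `entry g i j` is the entry of the underlying matrix. -/
theorem entry_eq (g : hypUnitary E) (i j : Fin 2) : entry g i j = mat (g : GL (Fin 2) E) i j := rfl

/-- The entries of a product. -/
theorem entry_mul (g h : hypUnitary E) (i j : Fin 2) :
    entry (g * h) i j = entry g i 0 * entry h 0 j + entry g i 1 * entry h 1 j := by
  simp only [entry, Subgroup.coe_mul, Units.val_mul, Matrix.mul_apply, Fin.sum_univ_two]

/-- The entries of `1`. -/
theorem entry_one (i j : Fin 2) : entry (1 : hypUnitary E) i j = (1 : Matrix (Fin 2) (Fin 2) E) i j :=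
  rfl

/-- `g⁻¹ * g = 1` entrywise. -/
theorem entry_inv_mul (g : hypUnitary E) (i j : Fin 2) :
    entry g⁻¹ i 0 * entry g 0 j + entry g⁻¹ i 1 * entry g 1 j = (1 : Matrix (Fin 2) (Fin 2) E) i j := by
  rw [← entry_mul, inv_mul_cancel, entry_one]

/-- The matrix of an upper-triangular element, in terms of its entries. -/
theorem mat_eq_upper (g : hypUnitary E) (hg : entry g 1 0 = 0) :
    mat (g : GL (Fin 2) E) = !![entry g 0 0, entry g 0 1; 0, entry g 1 1] := by
  have hg2 : mat (g : GL (Fin 2) E) 1 0 = 0 := hg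
  ext i j
  fin_cases i <;> fin_cases j <;> simp [entry_eq, hg2]

/-- The unitarity relations of an upper-triangular element `!![a, b; 0, d]` of `U(ℍ)`:
`ā d = 1` and `d̄ b + b̄ d = 0`. -/
theorem upper_relations (g : hypUnitary E) (hg : entry g 1 0 = 0) :
    star (entry g 0 0) * entry g 1 1 = 1 ∧
      star (entry g 1 1) * entry g 0 1 + star (entry g 0 1) * entry g 1 1 = 0 := by
  have hrel := (mem_hypUnitary_iff (g : GL (Fin 2) E)).mp g.2
  rw [mat_eq_upper g hg, hyp_eq, conjTranspose_fin_two, Matrix.mul_fin_two, Matrix.mul_fin_two]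
    at hrel
  simp only [star_zero, mul_zero, zero_mul, add_zero, zero_add, mul_one] at hrel
  constructor
  · have := congrFun (congrFun hrel 0) 1
    simpa using this
  · have := congrFun (congrFun hrel 1) 1
    simpa using this

/-- The `(0, 0)` entry of an upper-triangular element of `U(ℍ)` is non-zero. -/
theorem entry_00_ne_zero (g : hypUnitary E) (hg : entry g 1 0 = 0) : entry g 0 0 ≠ 0 := by
  intro h0
  have h := (upper_relations g hg).1
  rw [h0, star_zero, zero_mul] at h
  exact zero_ne_one h

/-- The Borel subgroup of `U(ℍ)`: the elements with vanishing `(1, 0)` entry, as a subgroup of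
`hypUnitary E`. -/
def borel (E : Type*) [Field E] [StarRing E] : Subgroup (hypUnitary E) where
  carrier := {g | entry g 1 0 = 0}
  one_mem' := by
    show entry (1 : hypUnitary E) 1 0 = 0
    rw [entry_one]
    simp
  mul_mem' := by
    intro g h hg hh
    simp only [Set.mem_setOf_eq] at hg hh ⊢
    rw [entry_mul, hg, hh]
    ring
  inv_mem' := by
    intro g hg
    simp only [Set.mem_setOf_eq] at hg ⊢
    have h := entry_inv_mul g 1 0
    rw [hg, mul_zero, add_zero] at h
    simp only [Matrix.one_apply_ne (show (1 : Fin 2) ≠ 0 by decide)] at h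
    rcases mul_eq_zero.mp h with h1 | h1
    · exact h1
    · exact absurd h1 (entry_00_ne_zero g hg)

/-- Membership in the Borel. -/
theorem mem_borel_iff (g : hypUnitary E) : g ∈ borel E ↔ entry g 1 0 = 0 := Iff.rfl

/-- `g ∈ B` if and only if `g` maps the vector `e₁ = ![1, 0]` into the line `E e₁`
(the Borel is the stabiliser of the isotropic line `⟨e₁⟩`). -/
theorem mem_borel_iff_stabilizes (g : hypUnitary E) :
    g ∈ borel E ↔ ∃ c : E, (mat (g : GL (Fin 2) E)).mulVec ![1, 0] = c • ![1, 0] := by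
  rw [mem_borel_iff]
  constructor
  · intro h
    refine ⟨entry g 0 0, ?_⟩
    have h2 : mat (g : GL (Fin 2) E) 1 0 = 0 := h
    ext i
    fin_cases i <;> simp [Matrix.mulVec, dotProduct, Fin.sum_univ_two, entry_eq, h2]
  · rintro ⟨c, hc⟩
    have := congrFun hc 1
    simpa [Matrix.mulVec, dotProduct, Fin.sum_univ_two, entry_eq] using this

/-- Every element of the Borel factors as `d(g₀₀) · u(g₀₀⁻¹ g₀₁)` — `B = T ⋉ N`. -/
theorem exists_diag_mul_unip (g : hypUnitary E) (hg : g ∈ borel E) :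
    ∃ (t : E) (ht : t ≠ 0) (x : E), star x = -x ∧
      (g : GL (Fin 2) E) = diagUnit t ht * unipUnit x := by
  have hg' : entry g 1 0 = 0 := hg
  obtain ⟨h01, h11⟩ := upper_relations g hg'
  have ha0 : entry g 0 0 ≠ 0 := entry_00_ne_zero g hg'
  have hsa : star (entry g 0 0) ≠ 0 := star_ne_zero.mpr ha0
  have hd : entry g 1 1 = (star (entry g 0 0))⁻¹ := by
    field_simp
    linear_combination h01
  refine ⟨entry g 0 0, ha0, (entry g 0 0)⁻¹ * entry g 0 1, ?_, ?_⟩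
  · -- `star (a⁻¹ b) = -(a⁻¹ b)` from `d̄ b + b̄ d = 0` with `d = ā⁻¹`
    rw [hd, star_inv₀, star_star] at h11
    rw [star_mul, star_inv₀]
    field_simp
    field_simp at h11
    linear_combination h11
  · ext : 1
    show mat (g : GL (Fin 2) E) = mat (diagUnit (entry g 0 0) ha0 * unipUnit _)
    rw [mat_eq_upper g hg', mat_mul, diagUnit_val, unipUnit_val, T5UnipotentCommutator.diag, unip,
      Matrix.mul_fin_two, hd]
    congr 1
    funext i j
    fin_cases i <;> fin_cases j <;> simp [mul_inv_cancel_left₀ ha0]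

/-- The homomorphism `B → Eˣ`, `g ↦ g₀₀` (the torus quotient of the Borel). -/
def torusHom : borel E →* Eˣ where
  toFun g := Units.mk0 (entry g.1 0 0) (entry_00_ne_zero g.1 g.2)
  map_one' := by
    ext
    simp [entry_one]
  map_mul' g h := by
    ext
    simp only [Units.val_mk0, Units.val_mul, Subgroup.coe_mul, entry_mul]
    have hh : entry (h : hypUnitary E) 1 0 = 0 := h.2
    rw [hh]
    ring

/-- The value of `torusHom`. -/
theorem torusHom_apply (g : borel E) : (torusHom g : E) = entry g.1 0 0 := rfl

/-- The kernel of `torusHom` consists exactly of the unipotent elements `u(x)`, `x̄ = -x`. -/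
theorem mem_ker_torusHom_iff (g : borel E) :
    g ∈ torusHom.ker ↔ ∃ x : E, star x = -x ∧ ((g : hypUnitary E) : GL (Fin 2) E) = unipUnit x := by
  rw [MonoidHom.mem_ker, Units.ext_iff, torusHom_apply, Units.val_one]
  constructor
  · intro h00
    obtain ⟨t, ht, x, hx, hg⟩ := exists_diag_mul_unip g.1 g.2
    have ht1 : t = 1 := by
      have := congrFun (congrFun (congrArg mat hg) 0) 0
      rw [mat_mul, diagUnit_val, unipUnit_val, T5UnipotentCommutator.diag, unip,
        Matrix.mul_fin_two] at this
      rw [← entry_eq, h00] at this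
      simpa using this.symm
    subst ht1
    refine ⟨x, hx, ?_⟩
    rw [hg]
    ext : 1
    show mat (diagUnit 1 ht * unipUnit x) = mat (unipUnit x)
    rw [mat_mul, diagUnit_val, T5UnipotentCommutator.diag, star_one, inv_one, ← Matrix.one_fin_two,
      Matrix.one_mul]
  · rintro ⟨x, hx, hg⟩
    rw [entry_eq, hg, unipUnit_val, unip]
    simp

/-- The commutator subgroup of the Borel lies in the kernel of `torusHom`, i.e. in `N`. -/
theorem commutator_borel_le_unipotent : commutator (borel E) ≤ (torusHom (E := E)).ker :=
  Abelianization.commutator_subset_ker (torusHom (E := E))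

/-- Every unipotent element of the Borel is a commutator of the Borel (file 23's identity,
read inside `B`), as soon as some `t ≠ 0` has `t t̄ ≠ 1`. -/
theorem unipotent_le_commutator_borel (t : E) (ht : t ≠ 0) (ht1 : t * star t ≠ 1) :
    (torusHom (E := E)).ker ≤ commutator (borel E) := by
  intro g hg
  obtain ⟨y, hy, hgy⟩ := (mem_ker_torusHom_iff g).mp hg
  have hc : star (t * star t - 1) = t * star t - 1 := by
    rw [star_sub, star_mul_star_self, star_one]
  have hx : star (y / (t * star t - 1)) = -(y / (t * star t - 1)) := star_div_eq_neg _ _ hy hc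
  have hdU : diagUnit t ht ∈ hypUnitary E := diagUnit_mem_hypUnitary t ht
  have huU : unipUnit (y / (t * star t - 1)) ∈ hypUnitary E := unipUnit_mem_hypUnitary _ hx
  have hdB : (⟨diagUnit t ht, hdU⟩ : hypUnitary E) ∈ borel E := by
    show entry (⟨diagUnit t ht, hdU⟩ : hypUnitary E) 1 0 = 0
    rw [entry_eq]
    simp [T5UnipotentCommutator.diag]
  have huB : (⟨unipUnit (y / (t * star t - 1)), huU⟩ : hypUnitary E) ∈ borel E := by
    show entry (⟨unipUnit (y / (t * star t - 1)), huU⟩ : hypUnitary E) 1 0 = 0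
    rw [entry_eq]
    simp [unip]
  have heq : g = ⁅(⟨⟨diagUnit t ht, hdU⟩, hdB⟩ : borel E),
      ⟨⟨unipUnit (y / (t * star t - 1)), huU⟩, huB⟩⁆ := by
    apply Subtype.ext
    apply Subtype.ext
    have h := unipUnit_eq_commutator t ht ht1 y
    rw [commutatorElement_def] at h
    rw [hgy, commutatorElement_def, Subgroup.coe_mul, Subgroup.coe_mul, Subgroup.coe_mul,
      Subgroup.coe_inv, Subgroup.coe_inv, Subgroup.coe_mul, Subgroup.coe_mul, Subgroup.coe_mul,
      Subgroup.coe_inv, Subgroup.coe_inv]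
    exact h
  rw [heq]
  exact Subgroup.commutator_mem_commutator (Subgroup.mem_top _) (Subgroup.mem_top _)

/-- `[B, B] = N`: the derived subgroup of the Borel is exactly the kernel of the torus quotient,
i.e. the unipotent radical, as soon as some `t ≠ 0` has `t t̄ ≠ 1`. -/
theorem commutator_borel_eq_unipotent (t : E) (ht : t ≠ 0) (ht1 : t * star t ≠ 1) :
    commutator (borel E) = (torusHom (E := E)).ker :=
  le_antisymm commutator_borel_le_unipotent (unipotent_le_commutator_borel t ht ht1)

/-- Every character of the Borel with values in a commutative group is trivial on `N`
(given some `t ≠ 0` with `t t̄ ≠ 1`). -/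
theorem character_borel_unip_eq_one {A : Type*} [CommGroup A] (χ : borel E →* A)
    (t : E) (ht : t ≠ 0) (ht1 : t * star t ≠ 1) (g : borel E) (hg : g ∈ (torusHom (E := E)).ker) :
    χ g = 1 :=
  MonoidHom.mem_ker.mp
    (Abelianization.commutator_subset_ker χ (unipotent_le_commutator_borel t ht ht1 hg))

end Summit.Ventures.HodgeRepro2.T5BorelHyperbolic
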